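import Literature.Topology.FourManifolds.SuspendedFamilyFoldChart
import HarnessLib

/-!
# Fold charts of arbitrary signature assembled from fibre coordinates

Topic `Literature/Topology/FourManifolds` (programme of the fact
`Literature.Topology.FourManifolds.exists_isSimplifiedBrokenLefschetzFibration`, Baykur–Saeki 2017, §2.1:
the singularities of a generic map `X⁴ → Σ²` are folds `(t, ±x² ± y² ± z²)` — "definite" when
all signs agree, "indefinite otherwise" — and cusps).  `IndefiniteFoldChartAssembly.lean` built
the chart for the indefinite signature `(+, +, -)` used by simplified broken Lefschetz fibrations;
this file does the same bookkeeping for an ARBITRARY triple of signs `(s₁, s₂, s₃)`, so that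
definite folds are covered too:

* `HasFoldChartSig F x s₁ s₂ s₃` — centred `C^∞` charts with
  `ψ ∘ F = (φ₀, s₁ φ₁² + s₂ φ₂² + s₃ φ₃²)` on the source of `φ`;
* `hasFoldChartSig_of_fibreCoords` — assembly from fibre coordinates
  `(F q)₁ = c(q₀) + s₁ Y₀(q)² + s₂ Y₁(q)² + s₃ Y₂(q)²` (source chart `(q₀ - x₀, Y)`, target chart
  `(a - x₀, b - c a)`, both by the inverse function theorem).

Everything is proved; `HasFoldChartSig` is the only definition; no named fact (D-0026).

## References

* R. İ. Baykur, O. Saeki, *Simplifying indefinite fibrations on 4-manifolds*, arXiv:1705.11169,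
  §2.1, p. 6 (folds `(t, ±x² ± y² ± z²)`, definite / indefinite). [BaykurSaeki2017]
* M. Golubitsky, V. Guillemin, *Stable Mappings and Their Singularities*, GTM 14 (1973), Ch. III
  §4, Thm. 4.5 (normal form of a submersion with folds). [GolubitskyGuillemin1973]
-/

noncomputable section

open Set Function Filter
open scoped Topology ContDiff

namespace Literature.Topology.FourManifolds

/-- Local notation: `𝔼 n` is the model Euclidean space `EuclideanSpace ℝ (Fin n)`. -/
local notation "𝔼 " n:arg => EuclideanSpace ℝ (Fin n)

/-- **Fold chart of signature `(s₁, s₂, s₃)`** of `F : ℝ⁴ → ℝ²` at `x`: centred `C^∞` charts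
`φ` at `x` and `ψ` at `F x` (with `C^∞` inverses) with
`ψ (F q) = (φ q₀, s₁ (φ q)₁² + s₂ (φ q)₂² + s₃ (φ q)₃²)` on the source of `φ` — Baykur–Saeki's
fold model `(t, ±x² ± y² ± z²)`. [cite: BaykurSaeki2017, §2.1, p. 6] -/
def HasFoldChartSig (F : 𝔼 4 → 𝔼 2) (x : 𝔼 4) (s₁ s₂ s₃ : ℝ) : Prop :=
  ∃ (φ : OpenPartialHomeomorph (𝔼 4) (𝔼 4)) (ψ : OpenPartialHomeomorph (𝔼 2) (𝔼 2)),
    x ∈ φ.source ∧ φ x = 0 ∧ MapsTo F φ.source ψ.source ∧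
    ContDiffOn ℝ ∞ φ φ.source ∧ ContDiffOn ℝ ∞ φ.symm φ.target ∧
    ContDiffOn ℝ ∞ ψ ψ.source ∧ ContDiffOn ℝ ∞ ψ.symm ψ.target ∧
    ∀ q ∈ φ.source, ψ (F q) 0 = φ q 0 ∧
      ψ (F q) 1 = s₁ * (φ q) 1 ^ 2 + s₂ * (φ q) 2 ^ 2 + s₃ * (φ q) 3 ^ 2

/-- **Fold chart of arbitrary signature from fibre coordinates.**  Let `F : ℝ⁴ → ℝ²` be
continuous, `O` an open neighbourhood of `x`, `Y : ℝ⁴ → ℝ³` `C^∞` on `O` with `Y x = 0` and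
derivative `Y'` at `x` injective on `{v | v₀ = 0}`, `c : ℝ → ℝ` `C^∞` on an open `V` containing
the `0`-coordinates of `O`, and `s₁, s₂, s₃ ∈ ℝ`, such that on `O`
`(F q)₀ = q₀` and `(F q)₁ = c(q₀) + s₁ Y₀(q)² + s₂ Y₁(q)² + s₃ Y₂(q)²`.
Then `F` has a fold chart of signature `(s₁, s₂, s₃)` at `x`. [cite: BaykurSaeki2017, §2.1] -/
theorem hasFoldChartSig_of_fibreCoords {F : 𝔼 4 → 𝔼 2} (hFc : Continuous F) {x : 𝔼 4}
    {O : Set (𝔼 4)} (hO : IsOpen O) (hxO : x ∈ O) {Y : 𝔼 4 → 𝔼 3} (hY : ContDiffOn ℝ ∞ Y O)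
    (hYx : Y x = 0) {Y' : 𝔼 4 →L[ℝ] 𝔼 3} (hYd : HasFDerivAt Y Y' x)
    (hinj : ∀ v : 𝔼 4, v 0 = 0 → Y' v = 0 → v = 0) {V : Set ℝ} (hV : IsOpen V)
    (hOV : ∀ q ∈ O, q 0 ∈ V) {c : ℝ → ℝ} (hc : ContDiffOn ℝ ∞ c V) (s₁ s₂ s₃ : ℝ)
    (hF0 : ∀ q ∈ O, F q 0 = q 0)
    (hF1 : ∀ q ∈ O, F q 1 = c (q 0) + (s₁ * (Y q) 0 ^ 2 + s₂ * (Y q) 1 ^ 2 + s₃ * (Y q) 2 ^ 2)) :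
    HasFoldChartSig F x s₁ s₂ s₃ := by
  have hxV : x 0 ∈ V := hOV x hxO
  -- the source chart `Φ q = (q₀ - x₀, Y q)`
  set Φ : 𝔼 4 → 𝔼 4 := fun q => WithLp.toLp 2 ![q 0 - x 0, Y q 0, Y q 1, Y q 2] with hΦ_def
  have hPc : ∀ i : Fin 4, ContDiff ℝ ∞ fun q : 𝔼 4 => q i := fun i =>
    (EuclideanSpace.proj i : 𝔼 4 →L[ℝ] ℝ).contDiff
  have hYi : ∀ i : Fin 3, ContDiffOn ℝ ∞ (fun q => Y q i) O := fun i =>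
    (EuclideanSpace.proj i : 𝔼 3 →L[ℝ] ℝ).contDiff.comp_contDiffOn hY
  have hΦs : ContDiffOn ℝ ∞ Φ O := by
    rw [contDiffOn_euclidean]
    intro i
    fin_cases i
    · simpa [hΦ_def] using ((hPc 0).sub contDiff_const).contDiffOn (s := O)
    · simpa [hΦ_def] using hYi 0
    · simpa [hΦ_def] using hYi 1
    · simpa [hΦ_def] using hYi 2
  -- its derivative at `x`
  set P : Fin 4 → (𝔼 4 →L[ℝ] ℝ) := fun i => EuclideanSpace.proj i with hP_def
  have hPd : ∀ i, HasFDerivAt (fun q : 𝔼 4 => q i) (P i) x := fun i =>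
    (EuclideanSpace.proj i : 𝔼 4 →L[ℝ] ℝ).hasFDerivAt
  set Yc : Fin 3 → (𝔼 4 →L[ℝ] ℝ) := fun i => (EuclideanSpace.proj i : 𝔼 3 →L[ℝ] ℝ).comp Y'
    with hYc
  have hYcd : ∀ i : Fin 3, HasFDerivAt (fun q => Y q i) (Yc i) x := fun i =>
    (EuclideanSpace.proj i : 𝔼 3 →L[ℝ] ℝ).hasFDerivAt.comp x hYd
  set Φ' : 𝔼 4 →L[ℝ] 𝔼 4 :=
    (P 0).smulRight (EuclideanSpace.single (0 : Fin 4) (1 : ℝ)) +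
      (Yc 0).smulRight (EuclideanSpace.single (1 : Fin 4) (1 : ℝ)) +
      (Yc 1).smulRight (EuclideanSpace.single (2 : Fin 4) (1 : ℝ)) +
      (Yc 2).smulRight (EuclideanSpace.single (3 : Fin 4) (1 : ℝ)) with hΦ'
  have hΦd : HasFDerivAt Φ Φ' x := by
    rw [← hasFDerivWithinAt_univ]
    refine hasFDerivWithinAt_euclidean.2 fun i => ?_
    fin_cases i
    · refine (((hPd 0).sub_const (x 0)).hasFDerivWithinAt (s := univ)).congr_fderiv ?_
      ext w
      simp [hΦ', hP_def]
    · refine ((hYcd 0).hasFDerivWithinAt (s := univ)).congr_fderiv ?_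
      ext w
      simp [hΦ', hP_def]
    · refine ((hYcd 1).hasFDerivWithinAt (s := univ)).congr_fderiv ?_
      ext w
      simp [hΦ', hP_def]
    · refine ((hYcd 2).hasFDerivWithinAt (s := univ)).congr_fderiv ?_
      ext w
      simp [hΦ', hP_def]
  -- `Φ'` is injective
  have hΦ'inj : Injective Φ' := by
    refine (injective_iff_map_eq_zero Φ').2 fun w hw => ?_
    have h0 : Φ' w 0 = 0 := by rw [hw]; rfl
    have h1 : Φ' w 1 = 0 := by rw [hw]; rfl
    have h2 : Φ' w 2 = 0 := by rw [hw]; rfl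
    have h3 : Φ' w 3 = 0 := by rw [hw]; rfl
    simp [hΦ', hP_def, hYc] at h0 h1 h2 h3
    refine hinj w h0 ?_
    ext i
    fin_cases i
    · simpa using h1
    · simpa using h2
    · simpa using h3
  obtain ⟨T₃, hT₃⟩ := exists_continuousLinearEquiv_coe_eq hΦ'inj
  obtain ⟨G₃, hG₃Φ, hxG₃, hG₃O, hG₃s, hG₃s'⟩ :=
    exists_openPartialHomeomorph_contDiffOn_symm hO hxO (m := ∞) (by simp) hΦs T₃
      (by rw [hT₃]; exact hΦd)
  -- the target chart `Ψ w = (w₀ - x₀, w₁ - c w₀)`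
  have hcd : HasDerivAt c (deriv c (x 0)) (x 0) :=
    ((hc.contDiffAt (hV.mem_nhds hxV)).differentiableAt (by simp)).hasDerivAt
  set y₀ : 𝔼 2 := F x with hy₀
  have hy₀0 : y₀ 0 = x 0 := hF0 x hxO
  set Ψ : 𝔼 2 → 𝔼 2 := fun w => WithLp.toLp 2 ![w 0 - x 0, w 1 - c (w 0)] with hΨ_def
  set O₄ : Set (𝔼 2) := {w | w 0 ∈ V} with hO₄_def
  have hP₂c : ∀ i : Fin 2, ContDiff ℝ ∞ fun w : 𝔼 2 => w i := fun i =>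
    (EuclideanSpace.proj i : 𝔼 2 →L[ℝ] ℝ).contDiff
  have hO₄o : IsOpen O₄ := hV.preimage (hP₂c 0).continuous
  have hy₀O₄ : y₀ ∈ O₄ := by
    show y₀ 0 ∈ V
    rw [hy₀0]
    exact hxV
  have hΨs : ContDiffOn ℝ ∞ Ψ O₄ := by
    rw [contDiffOn_euclidean]
    intro i
    fin_cases i
    · simpa [hΨ_def] using ((hP₂c 0).sub contDiff_const).contDiffOn (s := O₄)
    · have h : ContDiffOn ℝ ∞ (fun w : 𝔼 2 => w 1 - c (w 0)) O₄ :=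
        (hP₂c 1).contDiffOn.sub (hc.comp (hP₂c 0).contDiffOn fun w hw => hw)
      simpa [hΨ_def] using h
  set P₂ : Fin 2 → (𝔼 2 →L[ℝ] ℝ) := fun i => EuclideanSpace.proj i with hP₂_def
  have hP₂d : ∀ i, HasFDerivAt (fun w : 𝔼 2 => w i) (P₂ i) y₀ := fun i =>
    (EuclideanSpace.proj i : 𝔼 2 →L[ℝ] ℝ).hasFDerivAt
  set M₁ : 𝔼 2 →L[ℝ] ℝ := P₂ 1 - deriv c (x 0) • P₂ 0 with hM₁
  set Ψ' : 𝔼 2 →L[ℝ] 𝔼 2 :=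
    (P₂ 0).smulRight (EuclideanSpace.single (0 : Fin 2) (1 : ℝ)) +
      M₁.smulRight (EuclideanSpace.single (1 : Fin 2) (1 : ℝ)) with hΨ'
  have hcd' : HasDerivAt c (deriv c (x 0)) (y₀ 0) := by
    rw [hy₀0]
    exact hcd
  have hΨd : HasFDerivAt Ψ Ψ' y₀ := by
    rw [← hasFDerivWithinAt_univ]
    refine hasFDerivWithinAt_euclidean.2 fun i => ?_
    fin_cases i
    · refine (((hP₂d 0).sub_const (x 0)).hasFDerivWithinAt (s := univ)).congr_fderiv ?_
      ext w
      simp [hΨ', hP₂_def]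
    · have h := ((hP₂d 1).sub (hcd'.comp_hasFDerivAt y₀ (hP₂d 0))).hasFDerivWithinAt
        (s := univ)
      refine h.congr_fderiv ?_
      ext w
      simp [hΨ', hP₂_def, hM₁]
  have hΨ'inj : Injective Ψ' := by
    refine (injective_iff_map_eq_zero Ψ').2 fun w hw => ?_
    have h0 : Ψ' w 0 = 0 := by rw [hw]; rfl
    have h1 : Ψ' w 1 = 0 := by rw [hw]; rfl
    simp [hΨ', hP₂_def, hM₁] at h0 h1
    have hw1 : w 1 = 0 := by
      rw [h0, mul_zero, sub_zero] at h1
      exact h1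
    ext i
    fin_cases i
    · simpa using h0
    · simpa using hw1
  obtain ⟨T₄, hT₄⟩ := exists_continuousLinearEquiv_coe_eq hΨ'inj
  obtain ⟨G₄, hG₄Ψ, hyG₄, hG₄O, hG₄s, hG₄s'⟩ :=
    exists_openPartialHomeomorph_contDiffOn_symm hO₄o hy₀O₄ (m := ∞) (by simp) hΨs T₄
      (by rw [hT₄]; exact hΨd)
  -- assembly
  set S : Set (𝔼 4) := F ⁻¹' G₄.source with hS
  have hSo : IsOpen S := G₄.open_source.preimage hFc
  have hsrc : (G₃.restrOpen S hSo).source = G₃.source ∩ S :=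
    OpenPartialHomeomorph.restrOpen_source G₃ S hSo
  have htgt : (G₃.restrOpen S hSo).target ⊆ G₃.target := by
    intro z hz
    have h1 : (G₃.restrOpen S hSo).symm z ∈ (G₃.restrOpen S hSo).source :=
      (G₃.restrOpen S hSo).map_target hz
    have h2 : (G₃.restrOpen S hSo) ((G₃.restrOpen S hSo).symm z) = z :=
      (G₃.restrOpen S hSo).right_inv hz
    rw [hsrc] at h1
    have h3 : G₃ (G₃.symm z) = z := h2
    rw [← h3]
    exact G₃.map_source h1.1
  refine ⟨G₃.restrOpen S hSo, G₄, ?_, ?_, ?_, ?_, ?_, hG₄s, hG₄s', ?_⟩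
  · rw [hsrc]
    exact ⟨hxG₃, hyG₄⟩
  · show G₃ x = 0
    rw [hG₃Φ]
    ext i
    fin_cases i <;> simp [hΦ_def, hYx]
  · intro q hq
    rw [hsrc] at hq
    exact hq.2
  · rw [hsrc]
    exact hG₃s.mono inter_subset_left
  · exact hG₃s'.mono htgt
  · intro q hq
    rw [hsrc] at hq
    have hqO : q ∈ O := hG₃O hq.1
    have eφ : (G₃.restrOpen S hSo) q = Φ q := by
      rw [← hG₃Φ]
      rfl
    rw [eφ, hG₄Ψ]
    constructor
    · simp [hΨ_def, hΦ_def, hF0 q hqO]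
    · simp [hΨ_def, hΦ_def, hF0 q hqO, hF1 q hqO]

end Literature.Topology.FourManifolds
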